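import Literature.AlgebraicGeometry.Motives.UnramifiedCohomology
import HarnessLib

/-!
# Stub `stub_inheritAlongMorphism` of line `Sketch` for crux stmt-HodgeConjecture-18466: coniveau witnesses inherited along morphisms

This file is stub `stub_inheritAlongMorphism` of line `Sketch` for the crux
`Summit.HodgeConjecture.HodgeConjecture.Theses.GenericDivisibility.HodgeClassesGenericallyDivisible`
(item stmt-HodgeConjecture-18466).  It is the functoriality lemma (S-L1) of the card
`special-fibre-transfer`, stated for an ARBITRARY morphism `g : Y ⟶ 𝒳` of `ℂ`-schemes: if a class
`ζ ∈ Hᵏ(𝒳(ℂ); A)` dies on the complex points `(𝒳 ∖ 𝒟)(ℂ)` off a subset `𝒟 ⊆ 𝒳`, then its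
pull-back `g^* ζ ∈ Hᵏ(Y(ℂ); A)` dies on `(Y ∖ g⁻¹𝒟)(ℂ)`.

The proof is pure contravariant functoriality of singular cohomology (A. Hatcher, *Algebraic
Topology*, CUP 2002, §3.1, "Induced homomorphisms"): `g` restricts to a continuous map
`e : (Y ∖ g⁻¹𝒟)(ℂ) → (𝒳 ∖ 𝒟)(ℂ)`, the two composites
`(Y ∖ g⁻¹𝒟)(ℂ) ↪ Y(ℂ) → 𝒳(ℂ)` and `(Y ∖ g⁻¹𝒟)(ℂ) → (𝒳 ∖ 𝒟)(ℂ) ↪ 𝒳(ℂ)` are the same continuous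
map, hence `(g^* ζ)|_{(Y ∖ g⁻¹𝒟)(ℂ)} = e^* (ζ|_{(𝒳 ∖ 𝒟)(ℂ)}) = e^* 0 = 0`.

Everything is proved (no `sorry`, no named facts); the helper is prefixed
`genericDivisibility_sketch_`.

## References

* A. Hatcher, *Algebraic Topology*, CUP 2002, §3.1 p. 198–201 (induced homomorphisms,
  `(g ∘ f)^* = f^* ∘ g^*`). [HatcherAT2002]
-/

noncomputable section

open CategoryTheory AlgebraicGeometry

set_option linter.dupNamespace false

namespace Summit.HodgeConjecture.HodgeConjecture.Theorems

open Literature.AlgebraicGeometry.Motives Literature.AlgebraicGeometry.HodgeTheory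
  Literature.AlgebraicTopology.SingularHomology

/-- Restriction commutes with pull-back: for a morphism `g : Y ⟶ 𝒳` of `ℂ`-schemes, a subset
`𝒟 ⊆ 𝒳` and the restricted continuous map `e : (Y ∖ g⁻¹𝒟)(ℂ) → (𝒳 ∖ 𝒟)(ℂ)`, `P ↦ g ∘ P`, one has
`(g^* ζ)|_{(Y ∖ g⁻¹𝒟)(ℂ)} = e^* (ζ|_{(𝒳 ∖ 𝒟)(ℂ)})` (both composites `(Y ∖ g⁻¹𝒟)(ℂ) → 𝒳(ℂ)` are the
same continuous map; contravariant functoriality of `Hᵏ`, Hatcher §3.1).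
[cite: HatcherAT2002, §3.1] -/
theorem genericDivisibility_sketch_restrictToCompl_map (A : Type) [CommRing A]
    {Y 𝒳 : SchemeOver ℂ} (g : Y ⟶ 𝒳) (k : ℕ) (𝒟 : Set 𝒳.left)
    (ζ : singularCohomology A A (ComplexPoints 𝒳) k) :
    restrictToCompl A Y k (g.left.base ⁻¹' 𝒟)
        (singularCohomology.map A A
          (AlgPoints.mapContinuous g : C(ComplexPoints Y, ComplexPoints 𝒳)) k ζ) =
      singularCohomology.map A A
        (⟨fun P : complexPointsCompl Y (g.left.base ⁻¹' 𝒟) =>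
            (⟨AlgPoints.map g P.1, fun hP : (AlgPoints.map g P.1).pt ∈ 𝒟 => P.2 hP⟩ :
              complexPointsCompl 𝒳 𝒟),
          ((AlgPoints.continuous_map g).comp continuous_subtype_val).subtype_mk
            fun (P : complexPointsCompl Y (g.left.base ⁻¹' 𝒟))
              (hP : (AlgPoints.map g P.1).pt ∈ 𝒟) => P.2 hP⟩ :
          C(complexPointsCompl Y (g.left.base ⁻¹' 𝒟), complexPointsCompl 𝒳 𝒟)) k
        (restrictToCompl A 𝒳 k 𝒟 ζ) := by
  rw [← ModuleCat.comp_apply, ← ModuleCat.comp_apply, ← singularCohomology.map_comp,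
    ← singularCohomology.map_comp]
  rfl

/-- **Coniveau witnesses are inherited along morphisms** ((S-L1) of the card
`special-fibre-transfer`, for an arbitrary `ℂ`-morphism `g : Y ⟶ 𝒳`; the card's
`InheritFromTotalSpace` is the case of a fibre inclusion): if a class `ζ` on `𝒳(ℂ)` dies off a
subset `𝒟 ⊆ 𝒳`, its pull-back to `Y(ℂ)` dies off `g⁻¹(𝒟)`, by functoriality of `Hᵏ` along
`(Y ∖ g⁻¹𝒟)(ℂ) → (𝒳 ∖ 𝒟)(ℂ)` (Hatcher §3.1). [folklore] -/
theorem stub_inheritAlongMorphism : ∀ (A : Type) [CommRing A] ⦃Y 𝒳 : SchemeOver ℂ⦄ (g : Y ⟶ 𝒳)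
    (k : ℕ) (𝒟 : Set 𝒳.left) (ζ : singularCohomology A A (ComplexPoints 𝒳) k),
    restrictToCompl A 𝒳 k 𝒟 ζ = 0 →
      restrictToCompl A Y k (g.left.base ⁻¹' 𝒟)
        (singularCohomology.map A A
          (AlgPoints.mapContinuous g : C(ComplexPoints Y, ComplexPoints 𝒳)) k ζ) = 0 := by
  intro A _ Y 𝒳 g k 𝒟 ζ hζ
  rw [genericDivisibility_sketch_restrictToCompl_map, hζ, map_zero]

end Summit.HodgeConjecture.HodgeConjecture.Theorems

end
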